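import Mathlib
import HarnessLib
import HarnessLib.Audit
import Summits.RiemannHypothesis.Statement
import Literature.NumberTheory.LFunctions.RiemannXiProofs
import Literature.NumberTheory.LFunctions.ZetaLogDerivSeries
import Literature.Analysis.Complex.FourierPolyaKiKimProofs
import Literature.NumberTheory.DiophantineGeometry.NamedHypotheses
import Summits.RiemannHypothesis.RiemannHypothesis.Theorems.LaguerreSpeiserSplitDipInJensenDisc
import Summits.RiemannHypothesis.RiemannHypothesis.Theorems.LaguerreSignBelowVerifiedHeight
import Summits.RiemannHypothesis.RiemannHypothesis.Theorems.XiPrimeRealBelowVerifiedHeight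
import HarnessLib.Audit.Status.Attr

/-!
Route: LaguerreSpeiserSplit

# Route LaguerreSpeiserSplit — zeros of Ξ′ real (far field) + strict Laguerre L₁ > 0 on the line
(near field) give RH by Ki–Kim descent

X = X1 ∧ X2 ("it suffices to show X"). X1 (FAR FIELD, `XiPrimeOnLine`): every zero of Ξ′ is real —
equivalently every zero of
ξ′(s) has Re s = 1/2 (Speiser's theorem one derivative up, for ξ instead of ζ). X2 (NEAR FIELD,
`LaguerreOnLine`): the strict Laguerre
inequality L₁(t) = Ξ′(t)² − Ξ(t)Ξ″(t) > 0 at EVERY real t (Csordas 2015, Open Problem 4.7, strict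
form). Typed from the mwave sketch
laguerre-speiser-split (reader PASS); realises card xi-prime-herglotz-closure (its K1 = X1 verbatim;
its K2 is the critical-point
weakening of X2). Joint strength, stated plainly: RH ∧ (all zeros of ξ simple) ⇒ X1 ∧ X2 ⇒ RH;
neither half alone is known to give RH;
RH ⇒ X1 is printed (Conrey 1983) but not in the tree; RH ⇒ X2 is open (it contains simplicity of the
real zeros). The seam
X1 ∧ X2 ⇒ RH is PROVED in the deciding theorem (Laguerre–Pólya heredity for Ξ′ as a provable support
+ the Ki–Kim theorem on Fourier
critical points, in the tree); deciding / attacked crux: X1; X2 is the imported near-field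
complement (Csordas's named open problem).
Lean: `(∀ z : ℂ, deriv Literature.NumberTheory.LFunctions.riemannXiUpper z = 0 → z.im = 0) ∧ (∀ t :
ℝ, 0 < deriv (fun u : ℝ => (Literature.NumberTheory.LFunctions.riemannXiUpper (u : ℂ)).re) t ^ 2 -
(Literature.NumberTheory.LFunctions.riemannXiUpper (t : ℂ)).re * iteratedDeriv 2 (fun u : ℝ =>
(Literature.NumberTheory.LFunctions.riemannXiUpper (u : ℂ)).re) t)`

## Assembly
Proved, sorry-free, as the deciding theorem `closes` (glue.lean; kernel-checked in Sketch.lean, 0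
sorries): (0) Ξ is entire and real on ℝ
(`differentiable_riemannXi`, `im_riemannXiUpper_ofReal_holds`), so d/dt Re Ξ(t) = Re Ξ′(t) and
iterated derivatives commute with Re
(`KiKim.hasDerivAt_re_ofReal`, `KiKim.iteratedDeriv_re_ofReal`); (1) `HasNoFourierCriticalPoint (Re
Ξ)`: level 0 is LaguerreOnLine at a
critical point (Ξ′(c) = 0 ⇒ −Ξ(c)Ξ″(c) > 0), level l + 1 is level l of `HasNoFourierCriticalPoint
(Re Ξ′)` = LaguerreHeredityOfXiPrime
applied to XiPrimeOnLine; (2) with G(w) := xiSq(−w) (tree: `xiSq_sq`, `xiSq_conj`, `xiSq_zero_ne`,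
`norm_xiSq_le`, `differentiable_xiSq`)
one has G(z²) = Ξ(z), G real entire of order ≤ 7/8 < 1 with G(0) ≠ 0, so
`KiKim.noCrit_re_of_gammaChain` and
`KiKim.im_eq_zero_of_noCrit_of_order_lt_one` give: every zero of Ξ is real; (3)
`riemannHypothesis_iff_im_eq_zero_of_riemannXiUpper_eq_zero_holds.2`.

Rationale: WHY THIS LINE. Mechanism: an off-line zero quadruple a ± ib, −a ± ib of Ξ (b = its offset from the
critical line) leaves one of two fingerprints on the
REAL axis data of Ξ according to b versus the local zero spacing s ≈ 2π/log a — if b ≳ s/π it drags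
a critical point of Ξ off the real
axis (a non-real zero of Ξ′, ¬X1, "comb descent"), if b ≲ s/π it produces a real point with (Ξ′/Ξ)′
≥ 0, i.e. L₁ ≤ 0 (¬X2); the Ki–Kim
theorem on Fourier critical points [KiKim2000, Duke Math. J. 104, Thm 4.3 and Remark 4.5] makes the
dichotomy exhaustive for a real
entire function of order < 1 in z² such as Ξ, and the deciding theorem proves it: X2 is level 0 of
`HasNoFourierCriticalPoint (Re Ξ)`,
X1 plus Laguerre–Pólya heredity for Ξ′ (support, provable) gives every level ≥ 1, and
`KiKim.im_eq_zero_of_noCrit_of_order_lt_one`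
(tree) applied to G(w) = xiSq(−w), G(z²) = Ξ(z), returns "all zeros of Ξ real", i.e. RH by
`riemannHypothesis_iff_im_eq_zero_of_riemannXiUpper_eq_zero_holds` (tree). Sources: Conrey1983 (RH ⇒
X1; ≥ 81.37 % of the zeros of ξ′ on
the line; part II doi:10.1016/0022-314x(83)90007-0: ≥ 78.69 % on the line AND simple),
LevinsonMontgomery1974 and Speiser 1934 (the ζ′
prototype, `speiser_iff_holds` in the tree), CravenCsordasSmith1987 and Csordas–Ruttan–Varga 1991
(Numer. Algorithms 1, Laguerre numerics
for Ξ), Csordas arXiv:1309.0055 OP 4.7, KiKim2000. Imported areas: value distribution of real entire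
functions (Laguerre–Pólya class,
Fourier critical points) for the seam; mollified mean values of ξ^{(m)} (Levinson–Conrey) for the
far half, where that technology is
strongest (0.8137 for ξ′ against 0.4088 / 5⁄12 for ξ, `conrey_bound`, `przz_bound`); certified
real-variable numerics for the near half.
What it does that prior lines do not: route EarlyAppointments reaches the same Ki–Kim closure
through a COUNTING lever (appointments of
zeros of Ξ^{(k)} ahead of schedule) and declined the hereditary Laguerre chain as one RH-strength
item; here the chain is cut into a far
statement about ξ′ alone and a near statement about L₁ alone, each a named target with its own
literature and its own refutation scan;
the negatives index of the summit (2 entries: CharacterSums Conrey-positivity, UniversalFactor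
Laplace loophole) is untouched.

RANKED CRUXES. #2 XiPrimeOnLine (crux) — every zero of Ξ′ is real — equivalently every zero of ξ′(s)
lies on Re s = 1/2 (card xi-prime-herglotz-closure K1; sketch X1; the deciding crux). [difficulty:
open-problem] (why it might fail: implied by RH (LP heredity) with no unconditional engine beyond
proportions (81.37 %, Conrey 1983); a single off-line zero pair of ξ at distance ≳ (2/log γ) from
the line forces a non-real zero of Ξ′ and kills it.) [Conrey1983, doi:10.1016/0022-314x(83)90007-0,
LevinsonMontgomery1974, KiKim2000]
#3 LaguerreOnLine (crux) — the strict Laguerre inequality on the whole real axis, Ξ′(t)² − Ξ(t)Ξ″(t)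
> 0 for every real t (Csordas 2015 Open Problem 4.7, strict form; sketch X2); exactly "(Ξ′/Ξ)′ < 0
off the real zeros ∧ every real zero of Ξ is simple"; the imported near-field complement.
[difficulty: open-problem] (why it might fail: a Lehmer-type near-collision or an off-line pair
closer to the line than the local spacing gives a real t with L₁(t) ≤ 0; any multiple real zero
kills it too; certified only for |t| < 5.45·10⁸ (CRV 1991, via the RH numerics and Prop. 2.2).)
[arXiv:1309.0055, CravenCsordasSmith1987, paper:galaxy-pdf-4411015160, KiKim2000]
#9 LaguerreHeredityOfXiPrime (support) — Laguerre–Pólya heredity for Ξ′ (provable now): if every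
zero of Ξ′ is real then t ↦ Re Ξ′(t) has no Fourier critical points in the sense of Ki–Kim (Ξ′ is a
real entire function of order 1 and genus ≤ 1 in the LP closure once its zeros are real; LP is
closed under differentiation; a transcendental LP function has the strict sign pattern f·f″ < 0 at
non-zero critical points and f′·f″′ < 0 at the others, at every derivative level). Its proof must
use that Ξ′ is not a polynomial. [difficulty: provable-now] [KiKim2000, CravenCsordasSmith1987,
Ki2006]

TWO-LAYER PLAN. Birth skeletons (bc/, registered as Lines/birth.lean after open), nothing filed as
items now: XiPrimeOnLine ⇐ MonotoneModulusDeriv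
(σ ↦ |ξ′(σ + it)| strictly increasing on σ ≥ 1/2 for every t — the ξ′-analogue of the
Matiyasevich–Saidak–Zvengrowski / Lagarias
monotone-modulus criterion; ∂σ log|ξ′| = Re ξ″/ξ′) → (MonotoneModulusDeriv → XiPrimeOnLine,
provable: endpoint + ξ′(1 − s) = −ξ′(s));
LaguerreOnLine ⇐ LogDerivSlope (L₁ > 0 at real non-zeros, implied by RH alone) → SimpleOnLine (every
real zero of Ξ simple) → LaguerreOnLine
(glue proved in the skeleton). Foreseen later: XiPrimeOnLine ⇐ far (no zero of Ξ′ with |Im z|·log(2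
+ |Re z|) > C₀) + near (none below), k = 2.

KILL CRITERIA. A certified non-real zero of Ξ′ (argument-principle box count) refutes XiPrimeOnLine
— close `refuted:XiPrimeOnLine` (and, since RH ⇒ X1
is a theorem in print, it would refute RH itself). A certified real t with L₁(t) ≤ 0 refutes
LaguerreOnLine: if Ξ(t) ≠ 0 there it again
contradicts RH; if it is a multiple real zero only X2 dies — pivot by restating the near crux to its
off-zero form
(∀ t, Ξ(t) ≠ 0 → L₁(t) > 0), which `closes` equally consumes (level 0 is only used at critical
points with Ξ ≠ 0). A proof in print of
X1 ⇒ RH (converse of Conrey's heredity) would make X1 summit-equivalent — re-target to the birth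
split. RH proved elsewhere moots the route.

NOT DECOMPOSED YET. The far/near split of XiPrimeOnLine by the height-dependent tube |Im z| ≶
C/log|Re z| (constants not fixed); the window/tail regime
split of LaguerreOnLine (the window |t| ≤ 3·10¹² − 1 follows from Platt–Trudgian + Csordas Prop. 2.2
and is inside RH's known regime, so
it is not a rung); multiplicity-counted zero-counting functions for ξ′ (skeleton-local defs
`xiDerivZeroCount`, `xiDerivCriticalZeroCount`
in bc/XiPrimeOnLine_birth.lean, to be promoted to Literature when the Conrey rung is attacked); the
LP-heredity support's internal lemmas.

CHEAPEST FALSIFIER. (i) Lookup (run): is the converse "all zeros of ξ′ on the line ⇒ RH" in print?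
It would make X1 summit-equivalent. Conrey 1983 I/II prove
only RH ⇒ X1 [corpus:paper:doi-10-1016-0022-314x-83-90007-0 p.1]; no converse found (lit
search/vsearch "zeros of derivative xi
function critical line implies Riemann hypothesis"; galaxy "zeros of the derivatives of the
Riemann|Zeros of derivatives of Riemann's
xi": Conrey I/II, Levinson–Montgomery, BCR only). (ii) In-Lean: BC7 batteries on all three binders
CLEAN; C→S / S→C probes fail 3/3.
(iii) Numerics a refuter can run this week: sign scan of L₁ on (0, 10⁵] from Odlyzko zeros incl. the
Lehmer pair near t ≈ 7005.06
(sketch: 283 critical points on (0, 520], all real, min normalised L₁ > 0), and an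
argument-principle count of zeros of Ξ′ in
[T, T + 1] × [0.05, 0.5] for T ≤ 10⁴ (expected 0).

NUMBERS. κ(ξ′) ≥ 0.8137 on the line (Conrey1983 I, J. Number Theory 16, 49–74); on the line AND
simple β₁ > 0.7869, β₂ > 0.9314, …, a_m = 1 + O(m⁻²)
(Conrey1983 II, ibid. 17, 71–75, p. 72); κ(ξ) records 0.4088 (`Literature…conrey_bound`), 5/12
(`przz_bound`); mollifier ceilings
Radziwiłł 2012 / Bettin–Gonek 2017 (`Literature.Barriers.RiemannHypothesis.MollifierLimitations`: κ
< 1 for every θ < ∞); L₁ > 0 certified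
for |x| < 1.09·10⁹ in the H(x) = ξ(x/2)/8 normalisation (CRV 1991 [galaxy:pdf:4411015160 p.8];
Csordas 2015 Remark 4.8: implied by the RH
numerics via Prop. 2.2, hence now |t| < 3·10¹² by Platt–Trudgian); Levinson–Montgomery: Σ_{γ′<T}(β′
− 1/2) ~ (T/2π) log log T for ζ′.

DEFINITION REQUESTS. None blocking: `riemannXiUpper`, `xiSq`, `HasNoFourierCriticalPoint`,
`IsEntireOfOrderLt` exist. Wanted later (not filed now): multiplicity-
counted zero counts of ξ′ (`xiDerivZeroCount T`, `xiDerivCriticalZeroCount T`, modelled on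
`zetaZeroCount` / `criticalZeroCount` with
`analyticOrderAt (deriv riemannXi)`), for the Conrey-1983 rung; cite fact wanted: Conrey1983 I
Theorem 1 (κ(ξ′) ≥ 0.8137) as a NAMED FACT.

Novelty: Searches (2026-08-17): `lit search --hybrid "zeros of derivative of Riemann xi function critical
line Conrey"` (6: Conrey II held, trace-
formula volume pp.145–146, arXiv:1706.04593); `lit vsearch "all zeros of xi prime are real implies
Riemann hypothesis Laguerre inequality"`
(textbook hits only); `lit search "Csordas Laguerre open problem xi" --source local` (6:
arXiv:1309.0055 OP 4.7 p.7); `lit galaxy search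
"zeros of the derivatives of the Riemann|Laguerre inequalities and the zeros" --star all` (3: CRV
1991 pdf:4411015160, BCR
pdf:9155678564176035320, Conrey); `lit galaxy search "critical points of real entire
functions|Fourier critical point" --star all` (1,
irrelevant); `lean search riemannXiUpper|HasNoFourierCriticalPoint|speiser` (tree:
`speiser_iff_holds` for ζ′, Ki–Kim engine, EarlyAppointments
items 3182–3189); ideas index: xi-prime-herglotz-closure (open, graded variant),
clockwise-hodographs-speiser-ladder, derivative-ladder-
landing-appointments, critical-line-repulsion-tube, sum-difference-conditional-moments; `ledger
negatives --problem RiemannHypothesis` (2, unrelated).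
Nearest prior art found: card xi-prime-herglotz-closure (K1 = X1; refuter note: closure = KiKim2000
Thm 4.3 + Remark 4.5, Pólya 1930);
route-RiemannHypothesis-EarlyAppointments (Ki–Kim closure, counting lever, HereditaryLaguerre
stmt-RiemannHypothesis-3182); Conrey1983 (RH ⇒ X1,
81.37 %); arXiv:1309.0055 OP 4.7 (X2 non-strict posed as open); KiKim2000
doi:10.1215/S0012-7094-00-10413-9 Thm 4.3  [refs: 10.1215/S0012-7094-00-10413-9, 1706.04593, 1309.0055, doi:10.1215/S0012-7094-00-10413-9, KiKim2000, Conrey1983]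

Barriers (technique_class: Laguerre-Polya heredity, Levinson-Conrey, Ki-Kim closure): - technique_class: Laguerre-Polya heredity, Levinson-Conrey, Ki-Kim closure
- Literature.Barriers.RiemannHypothesis.JensenPolynomials: XiPrimeOnLine — outside: an n-free
statement about the zeros of Ξ′ itself (no Jensen polynomial, no shift n → ∞);
`Farmer2022_kimTheorem` / `GORZ2019_thm3_corollary` say eventual hyperbolicity carries no RH
information, and Farmer's witness class (real entire, order < 2, finitely many non-real zeros, e.g.
`quadExp`) VIOLATES the X1-analogue (its non-real pair is seen by the derivative) — positive
control, not obstruction [tree: JensenPolynomials.lean :155/:172; corpus:paper:arxiv-1309.0055 p.7].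
LaguerreOnLine — outside for the same reason: pointwise L₁ > 0 at shift 0, degree-free; the
Kim/Farmer witnesses fail L₁ > 0 near their non-real pair. LaguerreHeredityOfXiPrime — outside (a
heredity lemma for Ξ′, provable). (Kim's corollary `Farmer2022_kimCorollary`, same file, is placed
identically: it quantifies over eventual hyperbolicity of Jensen polynomials, not over zeros of Ξ′
or pointwise L₁.)
- Literature.Barriers.RiemannHypothesis.NewmanConjecture: LaguerreOnLine — outside: Λ ≥ 0
(Rodgers–Tao) says RH is at best barely true; X2 is a strict pointwise inequality with NO margin
(inf of normalised L₁ may be 0 along Lehmer pairs without violating X2); conceded that any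
QUANTITATIVE strengthening (L₁ ≥ c·Ξ′² uniformly) collides with it. XiPrimeOnLine — outside: no
flow-robust claim is made (only Λ(Ξ′) ≤ Λ(Ξ) heuristically). LaguerreHeredityOfXiPri

sub-problem: RiemannHypothesis · status: draft · opened planner-type-adba5b8f01-0 2026-08-17T18:01:04Z · rev 0 · ledger route-RiemannHypothesis-LaguerreSpeiserSplit
GENERATED by the gate from the ledger (D-0016/17). Provers cite these decls: `theorem foo : Summit.RiemannHypothesis.RiemannHypothesis.Theses.LaguerreSpeiserSplit.<Decl> := …` in Summits/RiemannHypothesis/RiemannHypothesis/Theorems/<Name>.lean.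
-/

namespace Summit.RiemannHypothesis.RiemannHypothesis.Theses.LaguerreSpeiserSplit

open scoped BigOperators Topology Manifold Classical MeasureTheory ProbabilityTheory Matrix InnerProductSpace ComplexConjugate ContinuousMap
open Filter Set Function TopologicalSpace MeasureTheory

attribute [summit_statement] _root_.Summit.RiemannHypothesis

open Summit

/-- item stmt-RiemannHypothesis-18896 · crux · rank 2 · open · by planner
why it might fail: implied by RH (LP heredity) with no unconditional engine beyond proportions (81.37 %, Conrey 1983); a single off-line zero pair of ξ at distance ≳ (2/log γ) from the line forces a non-real zero of Ξ′ and kills it.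
sources: Conrey1983, doi:10.1016/0022-314x(83)90007-0, LevinsonMontgomery1974, KiKim2000
[crux] every zero of Ξ′ is real — equivalently every zero of ξ′(s) lies on Re s = 1/2 (card
xi-prime-herglotz-closure K1; sketch X1; the deciding crux). [difficulty: open-problem] -/
@[route_item "route-RiemannHypothesis-LaguerreSpeiserSplit", crux]
def XiPrimeOnLine : Prop :=
  ∀ z : ℂ, deriv Literature.NumberTheory.LFunctions.riemannXiUpper z = 0 → z.im = 0

/-- item stmt-RiemannHypothesis-18897 · crux · rank 3 · open · by planner
why it might fail: a Lehmer-type near-collision or an off-line pair closer to the line than the local spacing gives a real t with L₁(t) ≤ 0; any multiple real zero kills it too; certified only for |t| < 5.45·10⁸ (CRV 1991, via the RH numerics and Prop. 2.2).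
sources: arXiv:1309.0055, CravenCsordasSmith1987, paper:galaxy-pdf-4411015160, KiKim2000
[crux] the strict Laguerre inequality on the whole real axis, Ξ′(t)² − Ξ(t)Ξ″(t) > 0 for every real
t (Csordas 2015 Open Problem 4.7, strict form; sketch X2); exactly "(Ξ′/Ξ)′ < 0 off the real zeros ∧
every real zero of Ξ is simple"; the imported near-field complement. [difficulty: open-problem] -/
@[route_item "route-RiemannHypothesis-LaguerreSpeiserSplit", crux]
def LaguerreOnLine : Prop :=
  ∀ t : ℝ, 0 < deriv (fun u : ℝ => (Literature.NumberTheory.LFunctions.riemannXiUpper (u : ℂ)).re) t ^ 2 - (Literature.NumberTheory.LFunctions.riemannXiUpper (t : ℂ)).re * iteratedDeriv 2 (fun u : ℝ => (Literature.NumberTheory.LFunctions.riemannXiUpper (u : ℂ)).re) t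

/-- item stmt-RiemannHypothesis-23196 · support · rank 4 · open · by planner
[crux] LINE «CLEAN NEAR FIELD» (D-0145, ideator rh-idea-2 g2; category (a)). RH-SENTENCE: if THIS
(C′: at every real critical point c of t ↦ Re Ξ(t) with Ξ(c) ≠ 0 one has Ξ(c)·Ξ″(c) < 0 — every real
critical value of Ξ off its zeros is a local maximum of |Ξ|, «every Lehmer dip crosses») and the
sibling crux XiPrimeOnLine (stmt-18896) are both proved, RH follows by the KERNEL theorem
Theorems.Splittings.JensenX4CleanSplit.rh_iff_xiPrimeOnLine_and_laguerreAtCriticalPoints (RH ⟺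
XiPrimeOnLine ∧ C′); each piece is implied by RH in kernel (laguerreAtCriticalPoints_of_rh,
xiPrimeOnLine_of_rh) and neither alone gives RH (BC2 probes C′→RH, C′→LaguerreOnLine FAIL;
separating models (z²+b²)cos z, b ≷ √2, and Cruxes/LaguerreOnLine/Disproof Model.F). WHY THIS LINE:
the served near crux LaguerreOnLine (18897) is EXACTLY XiPrimeOnLine ∧ C′ ∧ SZ_ℝ (simple real zeros;
kernel laguerreOnLine_iff_critical_and_simple) and RH ⇏ SZ_ℝ, so the honest (a)-piece is C′; the
registered skeleton Cruxes/LaguerreOnLine/Lines/clean-near-field.lean composes LaguerreOnLine from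
{C′, SZ_ℝ, XiPrimeOnLine} in kernel, putting this item in the cone of `closes`. WHY NOVEL vs listed
routes: no route on the D-0146 map S1–S -/
@[route_item "route-RiemannHypothesis-LaguerreSpeiserSplit"]
def LaguerreSignAtCriticalPoints : Prop :=
  ∀ c : ℝ, deriv (fun u : ℝ => (Literature.NumberTheory.LFunctions.riemannXiUpper (u : ℂ)).re) c = 0 → (Literature.NumberTheory.LFunctions.riemannXiUpper (c : ℂ)).re ≠ 0 → (Literature.NumberTheory.LFunctions.riemannXiUpper (c : ℂ)).re * iteratedDeriv 2 (fun u : ℝ => (Literature.NumberTheory.LFunctions.riemannXiUpper (u : ℂ)).re) c < 0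

/-- item stmt-RiemannHypothesis-23309 · support · rank 5 · open · by planner
[crux] LINE 2 «JENSEN SHADOW» (D-0145, ideator rh-idea-2 g2; category (a); technique = dictionary
import). «JENSEN-SHADOW-FREE»: no non-real zero ρ = γ + iη of Ξ (if there is any) has a real
critical point of Re Ξ (off the zeros of Ξ) inside its closed Jensen disc — every off-line zero
keeps horizontal distance > |η| from every real extremum of Ξ. RH-SENTENCE: if THIS and
XiPrimeOnLine (stmt-18896) are proved, then together with the RH-FREE lemma DipInJensenDisc
(stmt-23303, provable now) RH follows in kernel: JensenShadowFree ∧ DipInJensenDisc ⟹ C′ =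
LaguerreSignAtCriticalPoints (stmt-23196; three lines of logic, `cPrime_of_parts` in the line file)
and XiPrimeOnLine ∧ C′ ⟹ RH
(Theorems.Splittings.JensenX4CleanSplit.rh_iff_xiPrimeOnLine_and_laguerreAtCriticalPoints); so,
modulo the lemma, RH ⟺ XiPrimeOnLine ∧ JensenShadowFree (`rh_iff_xiPrime_and_shadowFree`). RH ⟹ THIS
trivially in kernel (no off-line zeros:
riemannHypothesis_iff_im_eq_zero_of_riemannXiUpper_eq_zero_holds); THIS ⇏ RH and THIS ⇏ C′ cheaply
(BC2 probes FAIL; it is strictly STRONGER than C′ — C′ tolerates an off-line pair whose disc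
contains extrema when the on-line repulsion dominates — and strictly weaker than RH: -/
@[route_item "route-RiemannHypothesis-LaguerreSpeiserSplit"]
def JensenShadowFree : Prop :=
  ∀ ρ : ℂ, Literature.NumberTheory.LFunctions.riemannXiUpper ρ = 0 → ρ.im ≠ 0 → ∀ c : ℝ, deriv (fun u : ℝ => (Literature.NumberTheory.LFunctions.riemannXiUpper (u : ℂ)).re) c = 0 → (Literature.NumberTheory.LFunctions.riemannXiUpper (c : ℂ)).re ≠ 0 → |ρ.im| < |c - ρ.re|

/-- item stmt-RiemannHypothesis-18898 · support · rank 9 · closed · proved by Summit.RiemannHypothesis.RiemannHypothesis.Theorems.Splittings.JensenX4LaguerreHeredity.laguerreHeredityOfXiPrime (prover) · by planner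
sources: KiKim2000, CravenCsordasSmith1987, Ki2006
[support] Laguerre–Pólya heredity for Ξ′ (provable now): if every zero of Ξ′ is real then t ↦ Re
Ξ′(t) has no Fourier critical points in the sense of Ki–Kim (Ξ′ is a real entire function of order 1
and genus ≤ 1 in the LP closure once its zeros are real; LP is closed under differentiation; a
transcendental LP function has the strict sign pattern f·f″ < 0 at non-zero critical points and
f′·f″′ < 0 at the others, at every derivative level). Its proof must use that Ξ′ is not a
polynomial. [difficulty: provable-now] -/
@[route_item "route-RiemannHypothesis-LaguerreSpeiserSplit", crux]
def LaguerreHeredityOfXiPrime : Prop :=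
  XiPrimeOnLine → Literature.Analysis.Complex.HasNoFourierCriticalPoint (fun t : ℝ => (deriv Literature.NumberTheory.LFunctions.riemannXiUpper (t : ℂ)).re)

-- `LaguerreHeredityOfXiPrime` holds: proved by `Summit.RiemannHypothesis.RiemannHypothesis.Theorems.Splittings.JensenX4LaguerreHeredity.laguerreHeredityOfXiPrime` (its module imports this route file, so no `_holds` link can be stated here).

/-- item stmt-RiemannHypothesis-23303 · support · rank 9 · closed · proved by Summit.RiemannHypothesis.RiemannHypothesis.Theorems.dipInJensenDisc (prover) · by planner
[support] RH-FREE and PROVABLE NOW (width for provers; LINE 2 «JENSEN SHADOW» of ideator rh-idea-2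
g2, category (a) one level below C′ = stmt-23196). «A non-crossing dip is shadowed»: if c is a real
critical point of t ↦ Re Ξ(t) off its zeros with the WRONG Laguerre sign Ξ(c)·Ξ″(c) ≥ 0, then some
NON-REAL zero ρ of Ξ has c in its closed Jensen disc, |c − Re ρ| ≤ |Im ρ| (< 1/2). This is the
real-axis form of Jensen's circle theorem / Laguerre's inequality: at a real x outside every closed
Jensen disc, (Ξ′/Ξ)′(x) = −Σ_a m(a)/(x−a)² + ψ_R′(x) with conjugate zeros paired, 2 Re (x−a)⁻² =
2[(x−γ)² − η²]/|x−a|⁴ > 0 for |x−γ| > |η|, and ψ_R′ → 0, so (Ξ′/Ξ)′(x) < 0 and at a critical point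
Ξ(x)Ξ″(x) < 0. ENGINE IN TREE (Hadamard-free): Literature.Analysis.Complex.JensenCircles
(`exists_logDeriv_eq_sum_pair`, `jensen_circle`; Ki–Kim 2000 §2 via Titchmarsh's Lemma α),
`LaguerreSep.re_deriv_logDeriv_neg` / `laguerre_inequality_strict` (XiLaguerreSeparationRH.lean §1,
Boas Thm 2.8.1 — the only-real-zeros case; here: same argument with x outside the discs),
`exists_growth_riemannXiUpper`, `im_riemannXiUpper_ofReal_holds`,
`exists_iteratedDeriv_riemannXiUpper_eq_zero 0` (Ξ has a zero, for strictne -/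
@[route_item "route-RiemannHypothesis-LaguerreSpeiserSplit"]
def DipInJensenDisc : Prop :=
  ∀ c : ℝ, deriv (fun u : ℝ => (Literature.NumberTheory.LFunctions.riemannXiUpper (u : ℂ)).re) c = 0 → (Literature.NumberTheory.LFunctions.riemannXiUpper (c : ℂ)).re ≠ 0 → 0 ≤ (Literature.NumberTheory.LFunctions.riemannXiUpper (c : ℂ)).re * iteratedDeriv 2 (fun u : ℝ => (Literature.NumberTheory.LFunctions.riemannXiUpper (u : ℂ)).re) c → ∃ ρ : ℂ, Literature.NumberTheory.LFunctions.riemannXiUpper ρ = 0 ∧ ρ.im ≠ 0 ∧ |c - ρ.re| ≤ |ρ.im|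

/-- `DipInJensenDisc` holds: proved by `Summit.RiemannHypothesis.RiemannHypothesis.Theorems.dipInJensenDisc`. -/
theorem DipInJensenDisc_holds : DipInJensenDisc := _root_.Summit.RiemannHypothesis.RiemannHypothesis.Theorems.dipInJensenDisc

/-- item stmt-RiemannHypothesis-23624 · support · rank 9 · closed · proved by Summit.RiemannHypothesis.RiemannHypothesis.Theorems.laguerreSignBelowVerifiedHeight (prover) · by planner
[support] RH-FREE RUNG (director-rh L38 of record; first rung of crux LaguerreSignAtCriticalPoints =
stmt-RiemannHypothesis-23196): under the NAMED numerical hypothesis RH-up-to-height 3000175332800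
(Platt–Trudgian 2021, cite tag PlattTrudgianBLMS2021 Thm 1), the Laguerre sign Ξ(c)·(Re Ξ)″(c) < 0
holds at every real critical point c of Re Ξ off the zeros with |c| < 3000175332800 − 1/2. Proof
plan = item DipInJensenDisc (stmt-RiemannHypothesis-23303, RH-free Jensen-circle theorem: a
wrong-sign extremum lies in the closed Jensen disc of a non-real zero, |Im ρ| < 1/2) + bookkeeping
that a non-real zero of Ξ_upper has |Re ρ| beyond the verified height. Registered 2-stub skeleton:
pub/ideators/rh-idea-2 SKELETON-rung-LaguerreSignBelowVerifiedHeight.lean. Why it might fail: it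
does not (provable now); informative as the certified-region half of instrument I-C′. Sources:
PlattTrudgianBLMS2021; Jensen 1913 / Craven–Csordas–Smith Ann. of Math. 125 (1987) (Jensen discs for
LP-type functions); tree JensenCircles.lean. Nothing here bears on the truth of RH. -/
@[route_item "route-RiemannHypothesis-LaguerreSpeiserSplit"]
def LaguerreSignBelowVerifiedHeight : Prop :=
  Literature.NumberTheory.DiophantineGeometry.riemannHypothesisUpTo_platt_trudgian → ∀ c : ℝ, |c| < 3000175332800 - 1 / 2 → deriv (fun u : ℝ => (Literature.NumberTheory.LFunctions.riemannXiUpper (u : ℂ)).re) c = 0 → (Literature.NumberTheory.LFunctions.riemannXiUpper (c : ℂ)).re ≠ 0 → (Literature.NumberTheory.LFunctions.riemannXiUpper (c : ℂ)).re * iteratedDeriv 2 (fun u : ℝ => (Literature.NumberTheory.LFunctions.riemannXiUpper (u : ℂ)).re) c < 0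

/-- `LaguerreSignBelowVerifiedHeight` holds: proved by `Summit.RiemannHypothesis.RiemannHypothesis.Theorems.laguerreSignBelowVerifiedHeight`. -/
theorem LaguerreSignBelowVerifiedHeight_holds : LaguerreSignBelowVerifiedHeight := _root_.Summit.RiemannHypothesis.RiemannHypothesis.Theorems.laguerreSignBelowVerifiedHeight

/-- item stmt-RiemannHypothesis-23771 · support · rank 9 · closed · proved by Summit.RiemannHypothesis.RiemannHypothesis.Theorems.xiPrimeRealBelowVerifiedHeight (prover) · by planner
[support] FAR RUNG of crux XiPrimeOnLine (18896), line «Levinson–Conrey ladder» (L42), far twin of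
rung LaguerreSignBelowVerifiedHeight (23624): under the named fact
riemannHypothesisUpTo_platt_trudgian (RH verified to height 3 000 175 332 800, Platt–Trudgian 2021)
every zero z of Ξ′ with |Re z| < 3000175332800 − 1/2 is real. RH-FREE width, size S: Jensen circle
theorem (tree engine Literature.Analysis.Complex.jensen_circle with exists_growth_riemannXiUpper,
im_riemannXiUpper_ofReal_holds) puts a non-real zero of Ξ′ in a closed Jensen disc of a non-real
zero ρ of Ξ (radius |Im ρ| < 1/2), and the landed helper
Theorems.LaguerreSignBelowVerifiedHeight.im_eq_zero_of_riemannXiUpper_eq_zero_of_abs_re_le (p586238)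
excludes such ρ with |Re ρ| ≤ H. Skeleton with ONE stub (stub_jensenNesting, shared with the L42
skeleton on 18896) + sorry-free kernel attached. Why it might fail: it cannot (conditional on the
named fact; Jensen 1913). Sources: Jensen 1913; KiKim2000 §2; PlattTrudgian2021 Thm 1. Nothing here
bears on the truth of RH. -/
@[route_item "route-RiemannHypothesis-LaguerreSpeiserSplit"]
def XiPrimeRealBelowVerifiedHeight : Prop :=
  Literature.NumberTheory.DiophantineGeometry.riemannHypothesisUpTo_platt_trudgian → ∀ z : ℂ, deriv Literature.NumberTheory.LFunctions.riemannXiUpper z = 0 → |z.re| < 3000175332800 - 1 / 2 → z.im = 0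

/-- `XiPrimeRealBelowVerifiedHeight` holds: proved by `Summit.RiemannHypothesis.RiemannHypothesis.Theorems.xiPrimeRealBelowVerifiedHeight`. -/
theorem XiPrimeRealBelowVerifiedHeight_holds : XiPrimeRealBelowVerifiedHeight := _root_.Summit.RiemannHypothesis.RiemannHypothesis.Theorems.xiPrimeRealBelowVerifiedHeight

/-- item stmt-RiemannHypothesis-18899 · assembly · rank 1 · closed · proved by Summit.RiemannHypothesis.RiemannHypothesis.Theorems.Splittings.JensenX4LaguerreHeredity.laguerreSpeiserSplit_assembly (prover) · by planner
sources: KiKim2000, Conrey1983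
[assembly] XiPrimeOnLine → LaguerreOnLine → LaguerreHeredityOfXiPrime → RH (the implication `closes`
proves; it consumes all three items). -/
@[route_item "route-RiemannHypothesis-LaguerreSpeiserSplit"]
def Assembly : Prop :=
  XiPrimeOnLine → LaguerreOnLine → LaguerreHeredityOfXiPrime → Summit.RiemannHypothesis

-- `Assembly` holds: proved by `Summit.RiemannHypothesis.RiemannHypothesis.Theorems.Splittings.JensenX4LaguerreHeredity.laguerreSpeiserSplit_assembly` (its module imports this route file, so no `_holds` link can be stated here).

/-! D-0027 §2.1 — DECIDING THEOREM (planner-authored via `route open/edit --closes-file`; by planner-type-adba5b8f01-0 2026-08-17T18:01:04Z):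
its hypotheses are this route's items and its conclusion the sub-problem Statement (glue_lint), and it elaborates with this file. -/

@[closes "route-RiemannHypothesis-LaguerreSpeiserSplit"] theorem closes (h1 : XiPrimeOnLine) (h2 : LaguerreOnLine) (h3 : LaguerreHeredityOfXiPrime) :
    _root_.Summit.RiemannHypothesis := by
  classical
  -- (0) `Ξ` is entire and real on `ℝ`
  have hΞ : Differentiable ℂ Literature.NumberTheory.LFunctions.riemannXiUpper := by
    have h : Literature.NumberTheory.LFunctions.riemannXiUpper =
        fun z => Literature.NumberTheory.LFunctions.riemannXi (1 / 2 + Complex.I * z) := rfl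
    rw [h]
    exact Literature.NumberTheory.LFunctions.differentiable_riemannXi.comp
      ((differentiable_const _).add ((differentiable_const _).mul differentiable_id))
  -- (1) the hereditary "no Fourier critical point" property of `t ↦ Re Ξ(t)`:
  --     level 0 from `LaguerreOnLine`, levels ≥ 1 from `XiPrimeOnLine` via the heredity support item.
  have hX : Literature.Analysis.Complex.HasNoFourierCriticalPoint
      (fun t : ℝ => (Literature.NumberTheory.LFunctions.riemannXiUpper (t : ℂ)).re) := by
    have hderiv : deriv (fun t : ℝ => (Literature.NumberTheory.LFunctions.riemannXiUpper (t : ℂ)).re)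
        = fun t : ℝ => (deriv Literature.NumberTheory.LFunctions.riemannXiUpper (t : ℂ)).re := by
      funext t
      exact (Literature.Analysis.Complex.KiKim.hasDerivAt_re_ofReal (hΞ.differentiableAt)).deriv
    have h31 := h3 h1
    intro l c hc1 hc0
    cases l with
    | zero =>
      have h2c := h2 c
      rw [zero_add, iteratedDeriv_one] at hc1
      rw [iteratedDeriv_zero] at hc0 ⊢
      rw [hc1] at h2c
      have h2c' : 0 < -((Literature.NumberTheory.LFunctions.riemannXiUpper (c : ℂ)).re *
          iteratedDeriv 2 (fun u : ℝ => (Literature.NumberTheory.LFunctions.riemannXiUpper (u : ℂ)).re) c) := by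
        linarith
      show (Literature.NumberTheory.LFunctions.riemannXiUpper (c : ℂ)).re *
          iteratedDeriv (0 + 2) (fun u : ℝ => (Literature.NumberTheory.LFunctions.riemannXiUpper (u : ℂ)).re) c < 0
      rw [zero_add]
      linarith
    | succ l =>
      have e0 : iteratedDeriv (l + 1) (fun t : ℝ => (Literature.NumberTheory.LFunctions.riemannXiUpper (t : ℂ)).re) c
          = iteratedDeriv l (fun t : ℝ => (deriv Literature.NumberTheory.LFunctions.riemannXiUpper (t : ℂ)).re) c := by
        rw [iteratedDeriv_succ', hderiv]
      have e1 : iteratedDeriv (l + 1 + 1) (fun t : ℝ => (Literature.NumberTheory.LFunctions.riemannXiUpper (t : ℂ)).re) c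
          = iteratedDeriv (l + 1) (fun t : ℝ => (deriv Literature.NumberTheory.LFunctions.riemannXiUpper (t : ℂ)).re) c := by
        rw [iteratedDeriv_succ', hderiv]
      have e2 : iteratedDeriv (l + 1 + 2) (fun t : ℝ => (Literature.NumberTheory.LFunctions.riemannXiUpper (t : ℂ)).re) c
          = iteratedDeriv (l + 2) (fun t : ℝ => (deriv Literature.NumberTheory.LFunctions.riemannXiUpper (t : ℂ)).re) c := by
        rw [show l + 1 + 2 = (l + 2) + 1 by ring, iteratedDeriv_succ', hderiv]
      rw [e1] at hc1
      rw [e0] at hc0 ⊢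
      rw [e2]
      exact h31 l c hc1 hc0
  -- (2) all zeros of `Ξ` are real: Ki–Kim 2000 Thm 4.3 (tree engine) on `G(w) = ξ₁(−w)`, `G(z²) = Ξ(z)`.
  have hreal : ∀ z : ℂ, Literature.NumberTheory.LFunctions.riemannXiUpper z = 0 → z.im = 0 := by
    let G : ℂ → ℂ := fun w => Literature.NumberTheory.LFunctions.xiSq (-w)
    have G_sq : ∀ z : ℂ, G (z ^ 2) = Literature.NumberTheory.LFunctions.riemannXiUpper z := by
      intro z
      show Literature.NumberTheory.LFunctions.xiSq (-(z ^ 2)) = _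
      have h : -(z ^ 2) = (Complex.I * z) ^ 2 := by rw [mul_pow, Complex.I_sq]; ring
      rw [h, Literature.NumberTheory.LFunctions.xiSq_sq]
      rfl
    have hGd : Differentiable ℂ G :=
      Literature.NumberTheory.LFunctions.differentiable_xiSq.comp differentiable_neg
    have G_real : ∀ x : ℝ, (G x).im = 0 := by
      intro x
      have h : (starRingEnd ℂ) (Literature.NumberTheory.LFunctions.xiSq (-(x : ℂ))) =
          Literature.NumberTheory.LFunctions.xiSq (-(x : ℂ)) := by
        rw [← Literature.NumberTheory.LFunctions.xiSq_conj, map_neg, Complex.conj_ofReal]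
      exact Complex.conj_eq_iff_im.mp h
    have G_zero_ne : G 0 ≠ 0 := by
      show Literature.NumberTheory.LFunctions.xiSq (-0) ≠ 0
      rw [neg_zero]
      exact Literature.NumberTheory.LFunctions.xiSq_zero_ne
    have G_zero_re_ne : (G 0).re ≠ 0 := by
      intro hre
      apply G_zero_ne
      apply Complex.ext
      · simpa using hre
      · simpa using G_real 0
    obtain ⟨C, hC⟩ := Literature.NumberTheory.LFunctions.norm_xiSq_le
    have G_orderLtOne : Literature.Analysis.Complex.IsEntireOfOrderLt 1 G := by
      refine ⟨hGd, 7 / 8, C, by norm_num, fun w => ?_⟩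
      have h := hC (-w)
      rw [norm_neg] at h
      exact h
    have hHγ : Literature.Analysis.Complex.HasNoFourierCriticalPoint (fun s : ℝ => (G ((s : ℂ) ^ 2)).re) := by
      have h : (fun s : ℝ => (G ((s : ℂ) ^ 2)).re) =
          fun t : ℝ => (Literature.NumberTheory.LFunctions.riemannXiUpper (t : ℂ)).re := by
        funext s; rw [G_sq]
      rw [h]
      exact hX
    have hHG : Literature.Analysis.Complex.HasNoFourierCriticalPoint (fun t : ℝ => (G t).re) :=
      Literature.Analysis.Complex.KiKim.noCrit_re_of_gammaChain hGd G_real G_zero_re_ne hHγ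
    intro z hz
    have hzsq : G (z ^ 2) = 0 := by rw [G_sq]; exact hz
    have him2 : (z ^ 2).im = 0 :=
      Literature.Analysis.Complex.KiKim.im_eq_zero_of_noCrit_of_order_lt_one G_orderLtOne G_zero_ne
        G_real hHG (z ^ 2) hzsq
    have hre2 : 0 ≤ (z ^ 2).re := by
      by_contra hneg
      push Not at hneg
      have halt := Literature.Analysis.Complex.KiKim.re_iteratedDeriv_zero_mul_succ_neg hGd G_zero_re_ne hHγ
      have h1' := Literature.Analysis.Complex.KiKim.re_iteratedDeriv_ne_zero_of_neg hGd G_real halt 0 hneg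
      have h2' : z ^ 2 = (((z ^ 2).re : ℝ) : ℂ) := Complex.ext (by simp) (by simpa using him2)
      rw [h2'] at hzsq
      simp only [iteratedDeriv_zero] at h1'
      exact h1' (by rw [hzsq]; simp)
    have him : (z ^ 2).im = 2 * z.re * z.im := by simp [sq, Complex.mul_im]; ring
    have hre : (z ^ 2).re = z.re * z.re - z.im * z.im := by simp [sq, Complex.mul_re]
    rw [him] at him2
    rw [hre] at hre2
    by_contra hzim
    have hzre : z.re = 0 := by
      rcases mul_eq_zero.mp him2 with h | h
      · rcases mul_eq_zero.mp h with h' | h'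
        · norm_num at h'
        · exact h'
      · exact absurd h hzim
    rw [hzre] at hre2
    have : 0 < z.im * z.im := mul_self_pos.mpr hzim
    linarith
  -- (3) Riemann's reformulation (PROVED in tree): all zeros of `Ξ` real ⇒ RH.
  exact Literature.NumberTheory.LFunctions.riemannHypothesis_iff_im_eq_zero_of_riemannXiUpper_eq_zero_holds.2
    hreal

end Summit.RiemannHypothesis.RiemannHypothesis.Theses.LaguerreSpeiserSplit
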